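import Summits.FinalStateConjecture.FinalStateConjecture.Theses.SignedCensus
import Literature.Geometry.Lorentzian.StationaryVacuumModuliTopology
import Literature.Geometry.Lorentzian.LeviCivitaProofs
import Literature.Geometry.Lorentzian.CausalityOpennessProofs
import HarnessLib

/-!
# Birth skeleton — crux stmt-FinalStateConjecture-10826 `Theses.SignedCensus.OpenUnderRotation` (crux, rank 3)
# line `birth` (skeleton registrar planner-skel-stmt-FinalStateConjecture-10826-0, 2026-08-17; BC3 of
# run/shared/lean/lens3/_common/BC.md)

The crux (route `SignedCensus`, rev 10): the set of exotic-free horizon-rotation levels is RIGHT-OPEN —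
`∀ s ≥ 0, P s → ∃ s' > s, P s'`, where `P s` ("no-hair up to level `s`") says that every REGULAR smooth
stationary AF vacuum black hole `𝓑 : StationaryAFBlackHole` (globally hyperbolic carrier, the slice a Cauchy
hypersurface, connected non-degenerate `𝓔⁺`, `T` normalised at infinity, `Ric = 0`) with `g(T,T) ≤ s` on `𝓔⁺`
has d.o.c. isometric to a sub-extremal Kerr exterior (a `C^∞` diffeomorphism `Φ : ⟨⟨M_ext⟩⟩ → Kerr.exterior M a`,
`|a| < M`, with `g_Kerr(dΦ v, dΦ w) = g(v, w)`).

The cut is the route's own TWO-LAYER PLAN for this crux ("OpenUnderRotation ⇐ ProperLevels → KerrIsolated"),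
typed over the definition request that has since LANDED — `Literature.Geometry.Lorentzian.StationaryVacuumModuli`
(`StationaryAFBlackHole.IsRegularVacuum` = verbatim the regularity chain of the route's items + `Ric = 0`) and
`….StationaryVacuumModuliTopology` (`StationaryAFBlackHole.ConvergesTo 𝓑s 𝓑`: pointed `C^∞` Cheeger–Gromov
convergence modulo scale of a sequence of stationary black holes, anchored at the causal structure of the ends,
with uniformly asymptotically flat rescaled data — the convergence generating the topology of the moduli space `𝔐`):

* `stub_exoticCompactness` (K — PROPER LEVELS ON THE EXOTIC LOCUS; the load-bearing, open-problem-sized stub):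
  every sequence of regular stationary vacuum black holes with UNIFORMLY BOUNDED level (`g(T,T) ≤ S` on every `𝓔ₙ⁺`)
  none of which has d.o.c. isometric to a sub-extremal Kerr exterior has a subsequence converging modulo scale
  (`ConvergesTo`) to a REGULAR stationary vacuum black hole.  The restriction to exotic sequences is forced, not
  cosmetic: the Kerr holes `a/M → 1` have level `a²/r₊² < 1` bounded and degenerate (`κ → 0`), so unrestricted
  "sublevel sets are sequentially compact in `𝔐`" is false as soon as Kerr is a point of `𝔐` (route falsifier (i));
  the line only ever needs compactness of a minimising sequence of COUNTEREXAMPLES.  Why it might fail (the route's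
  own risk line for this crux): a-priori curvature/injectivity control of stationary vacuum holes with bounded level
  modulo scale is not in print — Anderson's bound `|Rm| ≤ K/ρ²` (gr-qc/0001091, Thm. 0.1) needs `T` timelike and
  degenerates at the ergosurface, `κₙ → 0` (extremal degeneration) and pinching of `𝓔⁺` relative to the mass scale
  are non-compact directions the level does not obviously exclude off the Kerr curve.
  Sources: gr-qc/0001091 (Anderson 2000, §1.3, Lemma 1.3), arXiv:0909.4550 (Anderson–Khuri, §3),
  arXiv:1304.0487 (AIK 2014, Thm. 1.1: the level is their smallness parameter).  Size: open problem.
* `stub_levelSemicontinuity` (L — THE LEVEL IS LOWER SEMICONTINUOUS ALONG `ConvergesTo`; provable now, M/L):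
  if `𝓑ₙ → 𝓑` (`ConvergesTo`, all regular) and `g(Tₙ,Tₙ) ≤ cₙ` on `𝓔ₙ⁺` with `cₙ → s`, then `g(T,T) ≤ s` on `𝓔⁺`.
  Proof sketch: for `p ∈ 𝓔⁺ = ∂I⁻(M_ext) ∩ I⁺(M_ext)`, `I⁺(p) ∩ closure I⁻(M_ext) = ∅` (chronology is transitive
  and `I⁻` is open), so a small compact ball `B ∋ p` inside `W ∩ I⁺(M_ext)` contains points of `⟨⟨M_ext⟩⟩` and of
  `M ∖ closure I⁻(M_ext)`; by the four ANCHORING clauses of `ConvergenceData`, eventually `ψₙ(B) ⊆ I⁺(M_ext,ₙ)` meets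
  both `I⁻(M_ext,ₙ)` and its complement, hence meets `𝓔ₙ⁺` at some `ψₙ(qₙ)`, `qₙ ∈ B`; there
  `(ƛₙ⁻² ψₙ^* gₙ)(ƛₙ ψₙ^* Tₙ, ƛₙ ψₙ^* Tₙ)(qₙ) = gₙ(Tₙ,Tₙ)(ψₙ qₙ) ≤ cₙ` (the scales cancel), and `C⁰` convergence of
  `(ƛₙ⁻² ψₙ^* gₙ, ƛₙ ψₙ^* Tₙ) → (g, T)` on `B` gives `g(T,T)(p) ≤ s + ε` for every `ε`.  Why it might fail: only
  through a mis-transcription of `ConvergesTo` (e.g. if the eventual-embedding clause did not make `ψₙ` a local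
  diffeomorphism where the pull-backs are read) — a genuine check of the landed definition.  Sources: O'Neill 1983,
  Ch. 14 (Lemma 14.3, Cor. 14.1); Morgan–Tian 2007, Def. 5.3; Chruściel–Costa 2008, (2.2)–(2.5).
* `stub_kerrIsolation` (I — KERR IS ISOLATED IN THE MODULI TOPOLOGY; L/XL, literature-backed): if `𝓑ₙ → 𝓑`
  (`ConvergesTo`, all regular) and the d.o.c. of `𝓑` is isometric to a sub-extremal Kerr exterior, then so is the
  d.o.c. of `𝓑ₙ` for all large `n`.  This is Alexakis–Ionescu–Klainerman local rigidity ("uniqueness of smooth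
  stationary black holes in vacuum: small perturbations of the Kerr spaces", arXiv:0904.0982, Thm. 1.1; near the
  bifurcation sphere arXiv:0902.1173) transported to the moduli topology, with the linear input that the
  horizon-regular stationary zero modes of Kerr are `δKerr ⊕ gauge` for all `|a| < M` (Andersson–Häfner–Whiting,
  arXiv:2207.12952, Thm. 1.1).  Why it might fail: (a) `ConvergesTo` controls `𝓑ₙ` on images of compact subsets of
  `W` plus UNIFORM AF decay of a fixed order — the prover must propagate smallness across the intermediate region
  (weighted interpolation: uniform `O(r^{-α})` bounds + `C^k_loc` convergence ⇒ convergence in every weaker weighted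
  norm) and up to a bifurcation sphere that our carriers need not contain (Rácz–Wald extension of the non-degenerate
  horizon first); (b) AIK's smallness is of the Mars–Simon tensor in `C⁰` on the slice, not of `(g, T)` in `C^k_loc`.
  In Einstein–Klein–Gordon the analogue is FALSE on the Kerr curve (hairy Kerr bifurcation, barrier
  `HairyKerrBifurcation`): the stub rests on VACUUM mode rigidity.  Sources: arXiv:0904.0982, arXiv:0902.1173,
  arXiv:2207.12952, arXiv:1304.0487, gr-qc/9811021 (Rácz–Wald).  Size: L/XL.

Composition `OpenUnderRotation_of : Sig.stub_exoticCompactness → Sig.stub_levelSemicontinuity →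
Sig.stub_kerrIsolation → OpenUnderRotation` (REAL proof, ~40 lines, not a one-line seam): assume `P s`, `s ≥ 0`, and
that `P (s + 1/(n+1))` fails for every `n`; extract exotic regular counterexamples `𝓑ₙ` (levels `≤ s + 1/(n+1) ≤ s+1`),
pass to a convergent subsequence with regular limit `𝓑` (K), read off `level 𝓑 ≤ s` (L), conclude that `𝓑` is Kerr
from `P s` — the Levi-Civita instance and the openness facts `hF hP` of the limit being DISCHARGED by the tree's
theorems `PseudoRiemannianMetric.hasLeviCivita` and `isOpen_chronological{Future,Past}_holds_of_boundaryless` —, and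
contradict exoticness of the tail by isolation (I).  The `Sig.*` legend = the stub signatures verbatim, so that the
implication has named, admissible binders; the registered stubs themselves are DEF-FREE and self-contained
(`open … in`).  `openUnderRotation_of_stubs : OpenUnderRotation` = the crux BY NAME, closed modulo the three stubs.

Disproof.lean: none exists for this crux (`ledger crux ls stmt-FinalStateConjecture-10826`: no workfiles at
registration), so there is no `_false_without_` obligation to honour.  Negatives index (1 entry,
`not_UniformPhotonSphereChannels`): unrelated ODE channel estimate.  No stub is the crux or the summit in costume:
K and I are each one half of the compactness-plus-isolation argument (neither alone gives right-openness), L is a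
property of the landed convergence notion; BC3 probes `stub → OpenUnderRotation` / `stub → FinalStateConjecture` by
`first | exact? | simpa | aesop` fail for all three (registrar NOTES.md).
-/

set_option linter.dupNamespace false

noncomputable section

open scoped Manifold ContDiff Topology
open Filter Set Function Literature.Geometry.Lorentzian

namespace Summit.FinalStateConjecture.FinalStateConjecture.Cruxes.OpenUnderRotation.Birth

open Summit.FinalStateConjecture.FinalStateConjecture.Theses.SignedCensus (OpenUnderRotation)

/-! ## Legend: the three stub statements as named propositions (verbatim the registered signatures) -/

/-- Statement of `stub_exoticCompactness` (K): exotic regular holes with uniformly bounded level subconverge modulo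
scale to a regular hole. -/
def Sig.stub_exoticCompactness : Prop :=
  open Literature.Geometry.Lorentzian in open scoped Manifold in ∀ [Kerr.Facts] (S : ℝ) (𝓑s : ℕ → StationaryAFBlackHole.{0}), (∀ n, (𝓑s n).IsRegularVacuum) → (∀ n, ∀ p ∈ (𝓑s n).horizon, (𝓑s n).metric.val p ((𝓑s n).killing p) ((𝓑s n).killing p) ≤ S) → (∀ n, ∃ (hF : (𝓑s n).metric.isOpen_chronologicalFuture (𝓑s n).timeOrientation) (hP : (𝓑s n).metric.isOpen_chronologicalPast (𝓑s n).timeOrientation), ¬ ∃ (M a : ℝ) (_ : Kerr.IsSubextremal M a) (Φ : Diffeomorph (𝓡 4) 𝓘(ℝ, E4) ((𝓑s n).docOpens hF hP) (Kerr.exterior M a) ((⊤ : ℕ∞) : WithTop ℕ∞)), ∀ (y : (𝓑s n).docOpens hF hP) (v w : EuclideanSpace ℝ (Fin 4)), (Kerr.smoothMetric M a (Kerr.rPlus M a)).val (Φ y) (mfderiv (𝓡 4) 𝓘(ℝ, E4) Φ y v) (mfderiv (𝓡 4) 𝓘(ℝ, E4) Φ y w) = (𝓑s n).metric.val y.1 v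 w) → ∃ (𝓑 : StationaryAFBlackHole.{0}) (φ : ℕ → ℕ), StrictMono φ ∧ 𝓑.IsRegularVacuum ∧ StationaryAFBlackHole.ConvergesTo (𝓑s ∘ φ) 𝓑

/-- Statement of `stub_levelSemicontinuity` (L): the level is lower semicontinuous along `ConvergesTo`. -/
def Sig.stub_levelSemicontinuity : Prop :=
  open Literature.Geometry.Lorentzian in ∀ (𝓑s : ℕ → StationaryAFBlackHole.{0}) (𝓑 : StationaryAFBlackHole.{0}) (c : ℕ → ℝ) (s : ℝ), (∀ n, (𝓑s n).IsRegularVacuum) → 𝓑.IsRegularVacuum → StationaryAFBlackHole.ConvergesTo 𝓑s 𝓑 → (∀ n, ∀ p ∈ (𝓑s n).horizon, (𝓑s n).metric.val p ((𝓑s n).killing p) ((𝓑s n).killing p) ≤ c n) → Filter.Tendsto c Filter.atTop (nhds s) → ∀ p ∈ 𝓑.horizon, 𝓑.metric.val p (𝓑.killing p) (𝓑.killing p) ≤ s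

/-- Statement of `stub_kerrIsolation` (I): regular holes converging to a hole with Kerr d.o.c. eventually have Kerr
d.o.c. -/
def Sig.stub_kerrIsolation : Prop :=
  open Literature.Geometry.Lorentzian in open scoped Manifold in ∀ [Kerr.Facts] (𝓑s : ℕ → StationaryAFBlackHole.{0}) (𝓑 : StationaryAFBlackHole.{0}), (∀ n, (𝓑s n).IsRegularVacuum) → 𝓑.IsRegularVacuum → StationaryAFBlackHole.ConvergesTo 𝓑s 𝓑 → (∀ (hF : 𝓑.metric.isOpen_chronologicalFuture 𝓑.timeOrientation) (hP : 𝓑.metric.isOpen_chronologicalPast 𝓑.timeOrientation), ∃ (M a : ℝ) (_ : Kerr.IsSubextremal M a) (Φ : Diffeomorph (𝓡 4) 𝓘(ℝ, E4) (𝓑.docOpens hF hP) (Kerr.exterior M a) ((⊤ : ℕ∞) : WithTop ℕ∞)), ∀ (y : 𝓑.docOpens hF hP) (v w : EuclideanSpace ℝ (Fin 4)), (Kerr.smoothMetric M a (Kerr.rPlus M a)).val (Φ y) (mfderiv (𝓡 4) 𝓘(ℝ, E4) Φ y v) (mfderiv (𝓡 4) 𝓘(ℝ, E4) Φ y w) =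 𝓑.metric.val y.1 v w) → ∀ᶠ n in Filter.atTop, ∀ (hF : (𝓑s n).metric.isOpen_chronologicalFuture (𝓑s n).timeOrientation) (hP : (𝓑s n).metric.isOpen_chronologicalPast (𝓑s n).timeOrientation), ∃ (M a : ℝ) (_ : Kerr.IsSubextremal M a) (Φ : Diffeomorph (𝓡 4) 𝓘(ℝ, E4) ((𝓑s n).docOpens hF hP) (Kerr.exterior M a) ((⊤ : ℕ∞) : WithTop ℕ∞)), ∀ (y : (𝓑s n).docOpens hF hP) (v w : EuclideanSpace ℝ (Fin 4)), (Kerr.smoothMetric M a (Kerr.rPlus M a)).val (Φ y) (mfderiv (𝓡 4) 𝓘(ℝ, E4) Φ y v) (mfderiv (𝓡 4) 𝓘(ℝ, E4) Φ y w) = (𝓑s n).metric.val y.1 v w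

/-! ## Registered stubs (`sorry` only here; signatures def-free and self-contained) -/

/-- **K — PROPER LEVELS ON THE EXOTIC LOCUS** (compactness modulo scale and diffeomorphisms of regular stationary
vacuum black holes with bounded horizon-rotation level, restricted — as the line requires and as the degenerating
Kerr sequence `a/M → 1` forces — to holes whose d.o.c. is NOT isometric to a sub-extremal Kerr exterior): for every
bound `S` and every sequence `𝓑ₙ` of regular stationary vacuum black holes (`IsRegularVacuum`: globally hyperbolic
carrier, Cauchy slice, connected non-degenerate `𝓔⁺`, `T` normalised, `Ric = 0`) with `g(Tₙ,Tₙ) ≤ S` on every `𝓔ₙ⁺`,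
all exotic, some subsequence `𝓑_{φ(n)}` converges modulo scale (`StationaryAFBlackHole.ConvergesTo`: pointed `C^∞`
Cheeger–Gromov, anchored at the ends, uniformly AF rescaled data) to a REGULAR stationary vacuum black hole `𝓑`.
Why it might fail: no a-priori curvature/injectivity-radius control modulo scale is in print for stationary vacuum
holes with bounded level — Anderson's `|Rm| ≤ K/ρ²` needs `T` timelike (ergoregion), `κₙ → 0` and horizon pinching
are non-compact directions; AIK's `ε` depends on quantitative constants.  Sources: gr-qc/0001091 (§1.3, Lemma 1.3,
Thm. 0.1), arXiv:0909.4550 (§3), arXiv:1304.0487 (Thm. 1.1).  Size: open problem (the hard half of the crux). -/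
theorem stub_exoticCompactness : open Literature.Geometry.Lorentzian in open scoped Manifold in ∀ [Kerr.Facts] (S : ℝ) (𝓑s : ℕ → StationaryAFBlackHole.{0}), (∀ n, (𝓑s n).IsRegularVacuum) → (∀ n, ∀ p ∈ (𝓑s n).horizon, (𝓑s n).metric.val p ((𝓑s n).killing p) ((𝓑s n).killing p) ≤ S) → (∀ n, ∃ (hF : (𝓑s n).metric.isOpen_chronologicalFuture (𝓑s n).timeOrientation) (hP : (𝓑s n).metric.isOpen_chronologicalPast (𝓑s n).timeOrientation), ¬ ∃ (M a : ℝ) (_ : Kerr.IsSubextremal M a) (Φ : Diffeomorph (𝓡 4) 𝓘(ℝ, E4) ((𝓑s n).docOpens hF hP) (Kerr.exterior M a) ((⊤ : ℕ∞) : WithTop ℕ∞)), ∀ (y : (𝓑s n).docOpens hF hP) (v w : EuclideanSpace ℝ (Fin 4)), (Kerr.smoothMetric M a (Kerr.rPlus M a)).val (Φ y) (mfderiv (𝓡 4) 𝓘(ℝ, E4) Φ y v) (mfderiv (𝓡 4) 𝓘(ℝ, E4) Φ y w) = (𝓑s n).metric.val y.1 v w) → ∃ (𝓑 : StationaryAFBlackHole.{0})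 (φ : ℕ → ℕ), StrictMono φ ∧ 𝓑.IsRegularVacuum ∧ StationaryAFBlackHole.ConvergesTo (𝓑s ∘ φ) 𝓑 := by
  sorry

/-- **L — THE LEVEL IS LOWER SEMICONTINUOUS ALONG `ConvergesTo`** (a property of the landed convergence notion):
if regular holes `𝓑ₙ → 𝓑` (`StationaryAFBlackHole.ConvergesTo`, `𝓑` regular) and `g(Tₙ,Tₙ) ≤ cₙ` on `𝓔ₙ⁺` with
`cₙ → s`, then `g(T,T) ≤ s` on `𝓔⁺` — so the limit of a minimising sequence of levels `↓ s` has level `≤ s`.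
Proof route: for `p ∈ 𝓔⁺ = ∂I⁻(M_ext) ∩ I⁺(M_ext)` one has `I⁺(p) ∩ closure I⁻(M_ext) = ∅`, so a small compact ball
`B ∋ p` in `W ∩ I⁺(M_ext)` meets `⟨⟨M_ext⟩⟩` and `M ∖ closure I⁻(M_ext)`; by the anchoring clauses of `ConvergenceData`
eventually `ψₙ(B) ⊆ I⁺(M_ext,ₙ)` meets `I⁻(M_ext,ₙ)` and its complement, hence `𝓔ₙ⁺`, at some `ψₙ(qₙ)`, `qₙ ∈ B`, where
`(ƛₙ⁻² ψₙ^* gₙ)(ƛₙ ψₙ^* Tₙ, ƛₙ ψₙ^* Tₙ)(qₙ) = gₙ(Tₙ,Tₙ)(ψₙ qₙ) ≤ cₙ`; `C⁰` convergence on `B` then bounds `g(T,T)(p)`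
by `s + ε`.  Why it might fail: only by a mis-transcription inside `ConvergesTo` (it is a test of the landed
definition).  Sources: O'Neill 1983, Ch. 14, Lemma 14.3 and Cor. 14.1; Morgan–Tian 2007, Def. 5.3; Chruściel–Costa,
Astérisque 321 (2008), (2.2)–(2.5).  Size: M/L, provable now. -/
theorem stub_levelSemicontinuity : open Literature.Geometry.Lorentzian in ∀ (𝓑s : ℕ → StationaryAFBlackHole.{0}) (𝓑 : StationaryAFBlackHole.{0}) (c : ℕ → ℝ) (s : ℝ), (∀ n, (𝓑s n).IsRegularVacuum) → 𝓑.IsRegularVacuum → StationaryAFBlackHole.ConvergesTo 𝓑s 𝓑 → (∀ n, ∀ p ∈ (𝓑s n).horizon, (𝓑s n).metric.val p ((𝓑s n).killing p) ((𝓑s n).killing p) ≤ c n) → Filter.Tendsto c Filter.atTop (nhds s) → ∀ p ∈ 𝓑.horizon, 𝓑.metric.val p (𝓑.killing p) (𝓑.killing p) ≤ s := by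
  sorry

/-- **I — KERR IS ISOLATED IN THE MODULI TOPOLOGY** (Alexakis–Ionescu–Klainerman local rigidity of Kerr among
smooth stationary vacuum black holes, transported to pointed `C^∞` convergence modulo scale with uniform AF
control): if regular holes `𝓑ₙ → 𝓑` (`StationaryAFBlackHole.ConvergesTo`, `𝓑` regular) and the d.o.c. of `𝓑` is
isometric to a sub-extremal Kerr exterior (for all openness witnesses `hF hP` — they only name the open set
`⟨⟨M_ext⟩⟩`), then for all large `n` the d.o.c. of `𝓑ₙ` is isometric to a sub-extremal Kerr exterior.  Linear input:
horizon-regular stationary zero modes of Kerr are `δKerr ⊕ gauge` for all `|a| < M` (Andersson–Häfner–Whiting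
2022, Thm. 1.1); nonlinear input: AIK 2009/2010 (Carleman unique continuation for the Mars–Simon tensor from the
bifurcate horizon, smallness in `C⁰`).  Why it might fail: `ConvergesTo` sees `𝓑ₙ` only on images of compact subsets
of `W` plus uniform `O(r^{-α})` decay, so smallness must be propagated across the intermediate region (weighted
interpolation) and to a bifurcation sphere the carriers need not contain (Rácz–Wald extension first); and AIK measure
closeness by the Mars–Simon tensor, not by `(g, T)` in `C^k_loc`.  False for Einstein–Klein–Gordon (hairy Kerr
bifurcation): the stub is vacuum-specific.  Sources: arXiv:0904.0982 (Thm. 1.1), arXiv:0902.1173 (Thm. 1.1),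
arXiv:2207.12952 (Thm. 1.1), gr-qc/9811021, arXiv:1304.0487.  Size: L/XL. -/
theorem stub_kerrIsolation : open Literature.Geometry.Lorentzian in open scoped Manifold in ∀ [Kerr.Facts] (𝓑s : ℕ → StationaryAFBlackHole.{0}) (𝓑 : StationaryAFBlackHole.{0}), (∀ n, (𝓑s n).IsRegularVacuum) → 𝓑.IsRegularVacuum → StationaryAFBlackHole.ConvergesTo 𝓑s 𝓑 → (∀ (hF : 𝓑.metric.isOpen_chronologicalFuture 𝓑.timeOrientation) (hP : 𝓑.metric.isOpen_chronologicalPast 𝓑.timeOrientation), ∃ (M a : ℝ) (_ : Kerr.IsSubextremal M a) (Φ : Diffeomorph (𝓡 4) 𝓘(ℝ, E4) (𝓑.docOpens hF hP) (Kerr.exterior M a) ((⊤ : ℕ∞) : WithTop ℕ∞)), ∀ (y : 𝓑.docOpens hF hP) (v w : EuclideanSpace ℝ (Fin 4)), (Kerr.smoothMetric M a (Kerr.rPlus M a)).val (Φ y) (mfderiv (𝓡 4) 𝓘(ℝ, E4) Φ y v) (mfderiv (𝓡 4) 𝓘(ℝ, E4) Φ y w) = 𝓑.metric.val y.1 v w)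 → ∀ᶠ n in Filter.atTop, ∀ (hF : (𝓑s n).metric.isOpen_chronologicalFuture (𝓑s n).timeOrientation) (hP : (𝓑s n).metric.isOpen_chronologicalPast (𝓑s n).timeOrientation), ∃ (M a : ℝ) (_ : Kerr.IsSubextremal M a) (Φ : Diffeomorph (𝓡 4) 𝓘(ℝ, E4) ((𝓑s n).docOpens hF hP) (Kerr.exterior M a) ((⊤ : ℕ∞) : WithTop ℕ∞)), ∀ (y : (𝓑s n).docOpens hF hP) (v w : EuclideanSpace ℝ (Fin 4)), (Kerr.smoothMetric M a (Kerr.rPlus M a)).val (Φ y) (mfderiv (𝓡 4) 𝓘(ℝ, E4) Φ y v) (mfderiv (𝓡 4) 𝓘(ℝ, E4) Φ y w) = (𝓑s n).metric.val y.1 v w := by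
  sorry

/-! ## Proof vocabulary for the composition (sorry-free): the route's conclusion and graded predicate, named -/

/-- The conclusion of every decl of route `SignedCensus` for the hole `𝓑`: its d.o.c. `⟨⟨M_ext⟩⟩` (the open set
`𝓑.docOpens hF hP`) is isometric to a sub-extremal Kerr exterior — verbatim the unfolded `IsIsometricToKerrExterior`
of the route file. -/
def KerrExteriorConclusion (𝓑 : StationaryAFBlackHole.{0}) [Kerr.Facts]
    (hF : 𝓑.metric.isOpen_chronologicalFuture 𝓑.timeOrientation)
    (hP : 𝓑.metric.isOpen_chronologicalPast 𝓑.timeOrientation) : Prop :=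
  ∃ (M a : ℝ) (_ : Kerr.IsSubextremal M a) (Φ : Diffeomorph (𝓡 4) 𝓘(ℝ, E4) (𝓑.docOpens hF hP) (Kerr.exterior M a) ((⊤ : ℕ∞) : WithTop ℕ∞)), ∀ (y : 𝓑.docOpens hF hP) (v w : EuclideanSpace ℝ (Fin 4)), (Kerr.smoothMetric M a (Kerr.rPlus M a)).val (Φ y) (mfderiv (𝓡 4) 𝓘(ℝ, E4) Φ y v) (mfderiv (𝓡 4) 𝓘(ℝ, E4) Φ y w) = 𝓑.metric.val y.1 v w

/-- `P s` — no-hair up to horizon-rotation level `s`: verbatim the graded predicate inlined in the route's decls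
(`OpenUnderRotation` is literally `∀ s ≥ 0, P s → ∃ s' > s, P s'`, `openUnderRotation_iff` below is `Iff.rfl`). -/
def NoHairUpTo (s : ℝ) : Prop :=
  ∀ (𝓑 : StationaryAFBlackHole.{0}) [𝓑.metric.HasLeviCivita] [Kerr.Facts] (hF : 𝓑.metric.isOpen_chronologicalFuture 𝓑.timeOrientation) (hP : 𝓑.metric.isOpen_chronologicalPast 𝓑.timeOrientation), 𝓑.metric.IsGloballyHyperbolic 𝓑.timeOrientation → 𝓑.metric.IsCauchyHypersurface 𝓑.timeOrientation (Set.range 𝓑.embed) → IsConnected 𝓑.horizon → 𝓑.toSpacetime.IsNonDegenerateHorizon 𝓑.Mext → Filter.Tendsto (fun x ↦ 𝓑.metric.val (𝓑.embed x) (𝓑.killing (𝓑.embed x)) (𝓑.killing (𝓑.embed x))) (⨅ R : ℝ, Filter.principal (𝓑.e.far R)) (nhds (-1)) → (∀ p ∈ 𝓑.horizon, 𝓑.metric.val p (𝓑.killing p) (𝓑.killing p) ≤ s) → 𝓑.metric.toPseudoRiemannianMetric.IsRicciFlat → KerrExteriorConclusion 𝓑 hF hP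

/-- The crux is `∀ s ≥ 0, P s → ∃ s' > s, P s'` — by `Iff.rfl` (only the two names above are folded). -/
theorem openUnderRotation_iff :
    OpenUnderRotation ↔ ∀ s : ℝ, 0 ≤ s → NoHairUpTo s → ∃ s' : ℝ, s < s' ∧ NoHairUpTo s' :=
  Iff.rfl

/-- **A failure of no-hair at level `s` is witnessed by an EXOTIC REGULAR hole of level `≤ s`** (pure logic: negate the
curried chain; the instance binders become the fields of `IsRegularVacuum`, which quantify over the — proof-irrelevant —
Levi-Civita instance). -/
theorem exists_exotic_of_not {s : ℝ} (h : ¬ NoHairUpTo s) :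
    ∃ (𝓑 : StationaryAFBlackHole.{0}) (_ : Kerr.Facts), 𝓑.IsRegularVacuum ∧
      (∀ p ∈ 𝓑.horizon, 𝓑.metric.val p (𝓑.killing p) (𝓑.killing p) ≤ s) ∧
      ∃ (hF : 𝓑.metric.isOpen_chronologicalFuture 𝓑.timeOrientation)
        (hP : 𝓑.metric.isOpen_chronologicalPast 𝓑.timeOrientation), ¬ KerrExteriorConclusion 𝓑 hF hP := by
  unfold NoHairUpTo at h
  push Not at h
  obtain ⟨𝓑, inst, facts, hF, hP, hgh, hcs, hconn, hnd, hfar, hlev, hvac, hnot⟩ := h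
  exact ⟨𝓑, facts, ⟨hgh, hcs, hconn, fun {_} ↦ hnd, hfar, fun {_} ↦ hvac⟩, hlev, hF, hP, hnot⟩

/-- **No-hair up to level `s` applies to a regular hole of level `≤ s`**: the Levi-Civita instance the route's binder
asks for is DISCHARGED by the tree's theorem `PseudoRiemannianMetric.hasLeviCivita` (every `C^∞` metric on a
finite-dimensional model has its Levi-Civita connection), the remaining hypotheses are the fields of
`IsRegularVacuum`. -/
theorem conclusion_of_noHairUpTo {s : ℝ} (h : NoHairUpTo s) (𝓑 : StationaryAFBlackHole.{0}) [Kerr.Facts]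
    (hreg : 𝓑.IsRegularVacuum) (hlev : ∀ p ∈ 𝓑.horizon, 𝓑.metric.val p (𝓑.killing p) (𝓑.killing p) ≤ s)
    (hF : 𝓑.metric.isOpen_chronologicalFuture 𝓑.timeOrientation)
    (hP : 𝓑.metric.isOpen_chronologicalPast 𝓑.timeOrientation) : KerrExteriorConclusion 𝓑 hF hP := by
  haveI : 𝓑.metric.HasLeviCivita := 𝓑.metric.toPseudoRiemannianMetric.hasLeviCivita
  exact h 𝓑 hF hP hreg.isGloballyHyperbolic hreg.isCauchyHypersurface hreg.isConnected_horizon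
    hreg.isNonDegenerateHorizon hreg.tendsto_killingNormSq hlev hreg.isRicciFlat

/-! ## Composition: the crux BY NAME from the three stubs (real proof, no `sorry`) -/

/-- **`OpenUnderRotation` from K, L and I** — the compactness-and-isolation argument of the route's two-layer plan:
if no-hair holds up to level `s ≥ 0` but up to no level `s' > s`, pick exotic regular holes `𝓑ₙ` of level
`≤ s + 1/(n+1)` (failures of `P (s + 1/(n+1))`); by K a subsequence converges modulo scale to a regular hole `𝓑`;
by L its level is `≤ s`; by `P s` (with the limit's Levi-Civita instance and openness facts discharged by the
tree's theorems) the d.o.c. of `𝓑` is a sub-extremal Kerr exterior; by I so is the d.o.c. of `𝓑_{φ(n)}` for large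
`n` — contradicting exoticness. -/
theorem OpenUnderRotation_of :
    Sig.stub_exoticCompactness → Sig.stub_levelSemicontinuity → Sig.stub_kerrIsolation → OpenUnderRotation := by
  intro hK hL hI
  rw [openUnderRotation_iff]
  intro s hs hPs
  by_contra hno
  push Not at hno
  -- a minimising sequence of exotic regular counterexamples, levels `≤ s + 1/(n+1)`
  have hex : ∀ n : ℕ, ∃ (𝓑 : StationaryAFBlackHole.{0}) (_ : Kerr.Facts), 𝓑.IsRegularVacuum ∧
      (∀ p ∈ 𝓑.horizon, 𝓑.metric.val p (𝓑.killing p) (𝓑.killing p) ≤ s + 1 / ((n : ℝ) + 1)) ∧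
      ∃ (hF : 𝓑.metric.isOpen_chronologicalFuture 𝓑.timeOrientation)
        (hP : 𝓑.metric.isOpen_chronologicalPast 𝓑.timeOrientation), ¬ KerrExteriorConclusion 𝓑 hF hP := by
    intro n
    have hpos : (0 : ℝ) < 1 / ((n : ℝ) + 1) := by positivity
    exact exists_exotic_of_not (hno _ (by linarith))
  choose 𝓑s hfacts hreg hlev hexo using hex
  haveI : Kerr.Facts := hfacts 0
  -- the levels are uniformly bounded by `s + 1`
  have hbd : ∀ n, ∀ p ∈ (𝓑s n).horizon,
      (𝓑s n).metric.val p ((𝓑s n).killing p) ((𝓑s n).killing p) ≤ s + 1 := by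
    intro n p hp
    have h1 : (1 : ℝ) / ((n : ℝ) + 1) ≤ 1 :=
      div_le_one_of_le₀ (by linarith [(n.cast_nonneg : (0 : ℝ) ≤ n)]) (by positivity)
    exact (hlev n p hp).trans (by linarith)
  -- K: a regular limit of a subsequence
  obtain ⟨𝓑, φ, hφ, h𝓑, hconv⟩ := hK (s + 1) 𝓑s hreg hbd (fun n ↦ hexo n)
  -- L: the level of the limit is at most `s`
  have hc : Tendsto (fun n : ℕ ↦ s + 1 / (((φ n : ℕ) : ℝ) + 1)) atTop (𝓝 s) := by
    have h0 : Tendsto (fun n : ℕ ↦ 1 / (((φ n : ℕ) : ℝ) + 1)) atTop (𝓝 0) :=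
      tendsto_one_div_add_atTop_nhds_zero_nat.comp hφ.tendsto_atTop
    simpa using tendsto_const_nhds.add h0
  have hlev' : ∀ p ∈ 𝓑.horizon, 𝓑.metric.val p (𝓑.killing p) (𝓑.killing p) ≤ s :=
    hL (𝓑s ∘ φ) 𝓑 (fun n ↦ s + 1 / (((φ n : ℕ) : ℝ) + 1)) s (fun n ↦ hreg (φ n)) h𝓑 hconv
      (fun n ↦ hlev (φ n)) hc
  -- no-hair up to level `s`: the limit is Kerr
  have hKerr : ∀ (hF : 𝓑.metric.isOpen_chronologicalFuture 𝓑.timeOrientation)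
      (hP : 𝓑.metric.isOpen_chronologicalPast 𝓑.timeOrientation), KerrExteriorConclusion 𝓑 hF hP :=
    fun hF hP ↦ conclusion_of_noHairUpTo hPs 𝓑 h𝓑 hlev' hF hP
  -- I: the subsequence is eventually Kerr — contradicting exoticness
  obtain ⟨n, hn⟩ := (hI (𝓑s ∘ φ) 𝓑 (fun n ↦ hreg (φ n)) h𝓑 hconv hKerr).exists
  obtain ⟨hF, hP, hnot⟩ := hexo (φ n)
  exact hnot (hn hF hP)

/-- The crux by name, closed modulo the three registered stubs. -/
theorem openUnderRotation_of_stubs : OpenUnderRotation :=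
  OpenUnderRotation_of stub_exoticCompactness stub_levelSemicontinuity stub_kerrIsolation

end Summit.FinalStateConjecture.FinalStateConjecture.Cruxes.OpenUnderRotation.Birth

end
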